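import Summits.ValiantsHypothesis.ValiantsHypothesis.Theorems.EquivariantDialBlockGaugeCost
import Literature.Computability.AlgebraicComplexity.LRPencilOfMatrix

/-!
# Equivariant-dc dial: ARROW 1 OF THEOREM H IN COORDINATES — coordinate Levi lifts ⟹ block-gauge data (kernel), the
# `per_2` pad, and Theorem H conditional on ONE named paper statement `CoLeviLifts` + von zur Gathen's theorem
# (decomp-valiant workshop, lens 1, generation 17) — support file of census cell A; NOT a route

HONEST FRAMING.  `VP ≠ VNP` is NOT proved here and nothing in this file is progress on it.  Sorry-free SUPPORT file of
the census cell `A = EquivariantDialNode.EqHardBiPerm` (item `stmt-ValiantsHypothesis-23702`); it moves no tag on that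
cell and proves nothing about the symmetric determinantal complexity of `per_m`.  Kernel-checked, no `sorry`:
* §1–§2 bookkeeping: linear parts of affine entries in LR17's normal form `A(0) = Λ_{i₀}` ([LandsbergRessayre2017, §3.3],
  tree `lamMatrix`); the four blocks of a matrix at `i₀` (`borderEquiv i₀ : Unit ⊕ Fin N ≃ Fin (N+1)`);
  `blocks_of_inverse`: the inverse of a block-diagonal unit is block-diagonal with the inverse blocks.
* §3 `HasLeviLiftsAt Γ A i₀` — DEFINITION of a normal form (`A(0) = Λ_{i₀}`; every `γ ∈ Γ` has an exact lift `(g, h)`,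
  `A(γ·x) = g A h⁻¹`, block-diagonal for `{i₀} ⊔ ℍ`: LR17 §3.5–3.6 in coordinates, the conjugation into the Levi factor
  already performed) — and THE ASSEMBLY `hasBlockGaugeRepr_of_hasLeviLiftsAt` (KERNEL): such an `A` of size `N + 1` with
  `det A = f` gives `HasBlockGaugeRepr Γ f N`; the blocks of `A` at `i₀` are the data `[[ℓ, r], [c, 1 + Z]]` of
  `EquivariantDialLeVerrierABP.BlockGauge`, the lifts `g = diag(α, M)`, `h = diag(β, M)` (LR17 Lemma 3.3 forces the
  common `ℍ`-block) are its `LiftData`.  The tree had block gauge ⟹ program; this is representation ⟹ block gauge.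
* §4 the `m = 2` pad (KERNEL): `HasBlockGaugeRepr (biPermSubst 2) per_2 4` by the gauge `Z = 0`, `ℓ = 0`, `r_v = x_v`,
  `c_v = -½ x_v̄` (`v̄` the antipode of `Fin 2 × Fin 2`); the window group consists of bi-permutation matrices.
* §5 `CoLeviLifts` (NAMED PAPER STUB, hypothesis only — see its docstring) and THEOREM H CONDITIONAL (KERNEL):
  `CoLeviLifts → vonzurGathen1987_perm_detRepr_rank → BlockGaugeCost biPermSubst`, hence (tree arrows 2 + 3,
  `EquivariantDialBlockGaugeCost`) `GradingCost biPermSubst`, `A ⟺ A^lay`, `A ⟺ A^gr`.  Open inputs of Theorem H: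
  `CoLeviLifts` (paper), `vonzurGathen1987_perm_detRepr_rank` (fact); the heart of cell A is untouched.
No `instance`, no `notation`; nothing from `Literature` restated.
-/

set_option linter.dupNamespace false
namespace Summit.ValiantsHypothesis.ValiantsHypothesis.Theorems.EquivariantDialLayers

open MvPolynomial Matrix Literature.Computability.AlgebraicComplexity EquivariantDialGrading EquivariantDialNode
noncomputable section

/-! ## §1 Affine bookkeeping -/
section Affine
variable {σ : Type*} {k : Type*} [Field k] [Fintype σ]

/-- The LINEAR PART `Σ_v (∂p/∂x_v)(0) · x_v` of a polynomial. -/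
def linPart (p : MvPolynomial σ k) : MvPolynomial σ k := ∑ v, C (coeff (Finsupp.single v 1) p) * X v

/-- The linear part is a linear form. -/
theorem linPart_isHomogeneous (p : MvPolynomial σ k) : (linPart p).IsHomogeneous 1 :=
  IsHomogeneous.sum _ _ _ fun _ _ => isHomogeneous_C_mul_X _ _

/-- An affine polynomial is its constant term plus its linear part (`LRPencil.eq_affine_of_totalDegree_le_one`). -/
theorem eq_C_add_linPart {p : MvPolynomial σ k} (hp : p.totalDegree ≤ 1) : p = C (constantCoeff p) + linPart p :=
  LRPencil.eq_affine_of_totalDegree_le_one p hp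

/-- Entries of an affine matrix in LR17's normal form `A(0) = Λ_{i₀}`: `A_{ij} = (Λ_{i₀})_{ij} + linear`. -/
theorem entry_eq_of_constPart_eq_lamMatrix {s : ℕ} {A : Matrix (Fin s) (Fin s) (MvPolynomial σ k)} {i₀ : Fin s}
    (hA : ∀ i j, (A i j).totalDegree ≤ 1) (hΛ : constPart A = lamMatrix k i₀) (i j : Fin s) :
    A i j = C (if i = j then (if i = i₀ then 0 else 1) else 0) + linPart (A i j) := by
  have h := eq_C_add_linPart (hA i j)
  have hc : constantCoeff (A i j) = if i = j then (if i = i₀ then (0 : k) else 1) else 0 := by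
    rw [← constPart_apply A i j, hΛ, lamMatrix_apply]
  rwa [hc] at h
end Affine

/-! ## §2 Blocks at a distinguished index; the inverse of a block-diagonal unit -/
section Blocks
variable {R : Type*} {N : ℕ}

/-- `Unit ⊕ Fin N ≃ Fin (N + 1)`: the point goes to `i₀`, `Fin N` enumerates the complement `ℍ` by `i₀.succAbove`. -/
def borderEquiv (i₀ : Fin (N + 1)) : Unit ⊕ Fin N ≃ Fin (N + 1) :=
  (Equiv.sumComm Unit (Fin N)).trans (((Equiv.optionEquivSumPUnit.{0, 0} (Fin N)).symm).trans (finSuccEquiv' i₀).symm)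

/-- The point goes to `i₀`. -/
@[simp] theorem borderEquiv_inl (i₀ : Fin (N + 1)) (u : Unit) : borderEquiv i₀ (Sum.inl u) = i₀ := by simp [borderEquiv]

/-- `Fin N` enumerates the complement of `i₀`. -/
@[simp] theorem borderEquiv_inr (i₀ : Fin (N + 1)) (j : Fin N) : borderEquiv i₀ (Sum.inr j) = i₀.succAbove j := by
  simp [borderEquiv]

variable (P : Matrix (Fin (N + 1)) (Fin (N + 1)) R) (i₀ : Fin (N + 1))

/-- The corner `P_{i₀ i₀}` as a `1 × 1` block. -/
def crn : Matrix Unit Unit R := of fun _ _ => P i₀ i₀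
/-- The `i₀`-row of `P` off the diagonal. -/
def rowB : Matrix Unit (Fin N) R := of fun _ j => P i₀ (i₀.succAbove j)
/-- The `i₀`-column of `P` off the diagonal. -/
def colB : Matrix (Fin N) Unit R := of fun i _ => P (i₀.succAbove i) i₀
/-- The inner (`ℍ × ℍ`) block of `P`. -/
def blk : Matrix (Fin N) (Fin N) R := of fun i j => P (i₀.succAbove i) (i₀.succAbove j)

/-- Reindexing along `borderEquiv i₀` displays `P` as the block matrix of its four blocks at `i₀`. -/
theorem submatrix_borderEquiv :
    P.submatrix (borderEquiv i₀) (borderEquiv i₀) = fromBlocks (crn P i₀) (rowB P i₀) (colB P i₀) (blk P i₀) := by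
  ext (u | i) (u' | j) <;> simp [crn, rowB, colB, blk]

variable {k : Type*} [Field k] {i₀} {P' Q : Matrix (Fin (N + 1)) (Fin (N + 1)) k}

/-- THE INVERSE OF A BLOCK-DIAGONAL UNIT.  If `P' = diag(p, M)` at `i₀` (its `i₀`-row and `i₀`-column vanish off
the diagonal) and `Q` is a two-sided inverse, then `p · Q_{i₀i₀} = 1`, `Q` is block-diagonal at `i₀` and the inner
blocks are mutually inverse.  Pure block algebra, no determinants. -/
theorem blocks_of_inverse (hPQ : P' * Q = 1) (hQP : Q * P' = 1) (hr : rowB P' i₀ = 0) (hc : colB P' i₀ = 0) :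
    P' i₀ i₀ * Q i₀ i₀ = 1 ∧ rowB Q i₀ = 0 ∧ colB Q i₀ = 0 ∧ blk P' i₀ * blk Q i₀ = 1 ∧ blk Q i₀ * blk P' i₀ = 1 := by
  have h1 : (P' * Q).submatrix (borderEquiv i₀) (borderEquiv i₀) = 1 := by rw [hPQ, submatrix_one_equiv]
  have h2 : (Q * P').submatrix (borderEquiv i₀) (borderEquiv i₀) = 1 := by rw [hQP, submatrix_one_equiv]
  rw [← submatrix_mul_equiv P' Q _ (borderEquiv i₀) _, submatrix_borderEquiv, submatrix_borderEquiv, hr, hc,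
    fromBlocks_multiply, ← fromBlocks_one] at h1
  rw [← submatrix_mul_equiv Q P' _ (borderEquiv i₀) _, submatrix_borderEquiv, submatrix_borderEquiv, hr, hc,
    fromBlocks_multiply, ← fromBlocks_one] at h2
  simp only [Matrix.zero_mul, Matrix.mul_zero, add_zero, zero_add] at h1 h2
  obtain ⟨h11, h12, -, h22⟩ := fromBlocks_inj.mp h1
  obtain ⟨-, -, h21, h22'⟩ := fromBlocks_inj.mp h2
  have hs : P' i₀ i₀ * Q i₀ i₀ = 1 := by simpa [crn, Matrix.mul_apply] using congrFun (congrFun h11 ()) ()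
  refine ⟨hs, ?_, ?_, h22, h22'⟩
  · ext u j
    have e := congrFun (congrFun h12 u) j
    simp only [crn, rowB, Matrix.mul_apply, of_apply, Finset.univ_unique, Finset.sum_singleton, Matrix.zero_apply,
      mul_eq_zero] at e
    exact e.resolve_left (left_ne_zero_of_mul_eq_one hs)
  · ext i u
    have e := congrFun (congrFun h21 i) u
    simp only [crn, colB, Matrix.mul_apply, of_apply, Finset.univ_unique, Finset.sum_singleton, Matrix.zero_apply,
      mul_eq_zero] at e
    exact e.resolve_right (left_ne_zero_of_mul_eq_one hs)
end Blocks

/-! ## §3 Coordinate Levi lifts and the assembly of block-gauge data -/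
section Assembly
variable {σ : Type*} {k : Type*} [Field k] [Fintype σ] [DecidableEq σ] {N : ℕ}

/-- **COORDINATE LEVI LIFTS at `i₀`** (a normal form; LR17 §3.3 + §3.5–3.6 with the conjugation into the Levi factor
already performed): `A(0) = Λ_{i₀}` and every `γ ∈ Γ` has an EXACT lift `(g, h)`, `A(γ·x) = g A(x) h⁻¹`, BLOCK-DIAGONAL
for `{i₀} ⊔ ℍ` — stated minimally: the `i₀`-column of `g` and the `i₀`-row of `h` vanish off the diagonal (the `i₀`-row
of `g`, the `i₀`-column of `h` and the equality of the two `ℍ`-blocks are then forced by `A(0) = Λ_{i₀}`, Lemma 3.3). -/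
def HasLeviLiftsAt (Γ : Subgroup (GL σ k)) {s : ℕ} (A : Matrix (Fin s) (Fin s) (MvPolynomial σ k)) (i₀ : Fin s) : Prop :=
  constPart A = lamMatrix k i₀ ∧ ∀ γ ∈ Γ, ∃ g h : GL (Fin s) k,
    Matrix.linSubstEntries γ A = (g : Matrix (Fin s) (Fin s) k).map C * A * ((h⁻¹ : GL (Fin s) k) : Matrix (Fin s) (Fin s) k).map C ∧
      ∀ j, j ≠ i₀ → (g : Matrix (Fin s) (Fin s) k) j i₀ = 0 ∧ (h : Matrix (Fin s) (Fin s) k) i₀ j = 0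

/-- The block-gauge data READ OFF an affine matrix at `i₀`: the linear parts of its four blocks. -/
def leviBlockGauge (A : Matrix (Fin (N + 1)) (Fin (N + 1)) (MvPolynomial σ k)) (i₀ : Fin (N + 1)) : BlockGauge σ k (Fin N) where
  Z := of fun i j => linPart (A (i₀.succAbove i) (i₀.succAbove j))
  c i := linPart (A (i₀.succAbove i) i₀)
  r j := linPart (A i₀ (i₀.succAbove j))
  ℓ := linPart (A i₀ i₀)
  linZ _ _ := linPart_isHomogeneous _
  linc _ := linPart_isHomogeneous _
  linr _ := linPart_isHomogeneous _
  linℓ := linPart_isHomogeneous _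

omit [DecidableEq σ] in
/-- In the normal form `A(0) = Λ_{i₀}`, reindexing `A` along `borderEquiv i₀` gives EXACTLY the bordered matrix
`[[ℓ, r], [c, 1 + Z]]` of the data read off at `i₀`. -/
theorem submatrix_borderEquiv_eq_matrix {A : Matrix (Fin (N + 1)) (Fin (N + 1)) (MvPolynomial σ k)} {i₀ : Fin (N + 1)}
    (hA : ∀ i j, (A i j).totalDegree ≤ 1) (hΛ : constPart A = lamMatrix k i₀) :
    A.submatrix (borderEquiv i₀) (borderEquiv i₀) = (leviBlockGauge A i₀).matrix := by
  have hE := entry_eq_of_constPart_eq_lamMatrix hA hΛ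
  ext (u | i) (u' | j)
  · simp only [submatrix_apply, borderEquiv_inl, BlockGauge.matrix, border, fromBlocks_apply₁₁, of_apply]
    rw [hE i₀ i₀]; simp [leviBlockGauge]
  · simp only [submatrix_apply, borderEquiv_inl, borderEquiv_inr, BlockGauge.matrix, border, fromBlocks_apply₁₂, of_apply]
    rw [hE i₀ (i₀.succAbove j)]; simp [leviBlockGauge, (Fin.succAbove_ne i₀ j).symm]
  · simp only [submatrix_apply, borderEquiv_inl, borderEquiv_inr, BlockGauge.matrix, border, fromBlocks_apply₂₁, of_apply]
    rw [hE (i₀.succAbove i) i₀]; simp [leviBlockGauge, Fin.succAbove_ne i₀ i]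
  · simp only [submatrix_apply, borderEquiv_inr, BlockGauge.matrix, border, fromBlocks_apply₂₂, Matrix.add_apply, Matrix.one_apply]
    rw [hE (i₀.succAbove i) (i₀.succAbove j)]
    by_cases hij : i = j <;> simp [leviBlockGauge, hij, Fin.succAbove_ne i₀ j]

/-- BLOCK ALGEBRA OF A BLOCK-DIAGONAL LIFT: if `[[ℓ, r], [c, 1 + Z]](γ·x) = diag(a, M) · [[ℓ, r], [c, 1 + Z]] · diag(b⁻¹, M⁻¹)`
as matrices, then `(M, a, b)` are block-gauge lift data at `γ`. -/
theorem nonempty_liftData_of_blocks (B : BlockGauge σ k (Fin N)) {γ : GL σ k} (a b : kˣ) (M : GL (Fin N) k)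
    (h : Matrix.linSubstEntries γ B.matrix =
      (fromBlocks (of fun (_ _ : Unit) => (a : k)) 0 0 (M : Matrix (Fin N) (Fin N) k)).map C * B.matrix *
        (fromBlocks (of fun (_ _ : Unit) => ((b⁻¹ : kˣ) : k)) 0 0 ((M⁻¹ : GL (Fin N) k) : Matrix (Fin N) (Fin N) k)).map C) :
    Nonempty (B.LiftData γ) := by
  have hMMi : ((M : Matrix (Fin N) (Fin N) k).map C : Matrix (Fin N) (Fin N) (MvPolynomial σ k)) *
      ((M⁻¹ : GL (Fin N) k) : Matrix (Fin N) (Fin N) k).map C = 1 := by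
    rw [← Matrix.map_mul, Units.mul_inv, Matrix.map_one C (map_zero C) (map_one C)]
  rw [BlockGauge.matrix, border, Matrix.linSubstEntries] at h
  simp only [fromBlocks_map, Matrix.map_zero _ (map_zero C), fromBlocks_multiply, Matrix.zero_mul, Matrix.mul_zero,
    add_zero, zero_add] at h
  obtain ⟨h11, h12, h21, h22⟩ := fromBlocks_inj.mp h
  refine ⟨{ M := M, α := a, β := b, mapZ := ?_, mapc := ?_, mapr := ?_, mapℓ := ?_ }⟩
  · rw [Matrix.map_add _ (map_add (linSubst σ k (γ : Matrix σ σ k))),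
      Matrix.map_one _ (map_zero (linSubst σ k (γ : Matrix σ σ k))) (map_one (linSubst σ k (γ : Matrix σ σ k))),
      Matrix.mul_add, Matrix.add_mul, Matrix.mul_one, hMMi] at h22
    exact add_left_cancel h22
  · intro i
    have e := congrFun (congrFun h21 i) ()
    simp only [Matrix.map_apply, of_apply, Matrix.mul_apply, Finset.univ_unique, Finset.sum_singleton] at e
    rw [e, mul_comm]
    simp only [Matrix.mulVec, dotProduct, Matrix.map_apply]
  · intro j
    have e := congrFun (congrFun h12 ()) j
    simp only [Matrix.map_apply, of_apply, Matrix.mul_apply, Finset.univ_unique, Finset.sum_singleton] at e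
    rw [e]
    simp only [Matrix.vecMul, dotProduct, Matrix.map_apply, Finset.mul_sum, mul_assoc]
  · have e := congrFun (congrFun h11 ()) ()
    simp only [Matrix.map_apply, of_apply, Matrix.mul_apply, Finset.univ_unique, Finset.sum_singleton] at e
    rw [e, map_mul]; ring

/-- **THE ASSEMBLY (arrow 1 of Theorem H in coordinates, KERNEL).**  An affine determinantal representation of `f` of
size `N + 1` with coordinate Levi lifts on `Γ` gives `Γ`-equivariant block-gauge data of inner size `N`.  The inner gauge
`M` is the common `ℍ`-block of `g` and `h` (a unit with inverse the `ℍ`-block of `h⁻¹`, by `blocks_of_inverse`), the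
characters are `α = g_{i₀i₀}`, `β = h_{i₀i₀}`. -/
theorem hasBlockGaugeRepr_of_hasLeviLiftsAt {Γ : Subgroup (GL σ k)} {f : MvPolynomial σ k}
    {A : Matrix (Fin (N + 1)) (Fin (N + 1)) (MvPolynomial σ k)} {i₀ : Fin (N + 1)}
    (hA : IsAffineDetRepr f A) (hL : HasLeviLiftsAt Γ A i₀) : HasBlockGaugeRepr Γ f N := by
  obtain ⟨hΛ, hlift⟩ := hL
  have hAe := submatrix_borderEquiv_eq_matrix hA.1 hΛ
  refine ⟨leviBlockGauge A i₀, ?_, fun γ hγ => ?_⟩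
  · rw [← hAe, det_submatrix_equiv_self, hA.2]
  obtain ⟨g, h, hgh, hlevi⟩ := hlift γ hγ
  -- LR17 Lemma 3.3: the lift stabilises `Λ_{i₀}`; with the Levi condition, `g` and `h` are block-diagonal at `i₀`
  have h33 := mul_constPart_eq_of_linSubstEntries_eq hgh
  rw [hΛ, mul_lamMatrix_eq_lamMatrix_mul_iff] at h33
  obtain ⟨hgrow, hhcol, hgh'⟩ := h33
  have hrowG : rowB (g : Matrix (Fin (N + 1)) (Fin (N + 1)) k) i₀ = 0 := by ext u j; exact hgrow _ (Fin.succAbove_ne i₀ j)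
  have hcolG : colB (g : Matrix (Fin (N + 1)) (Fin (N + 1)) k) i₀ = 0 := by ext i u; exact (hlevi _ (Fin.succAbove_ne i₀ i)).1
  have hrowH : rowB (h : Matrix (Fin (N + 1)) (Fin (N + 1)) k) i₀ = 0 := by ext u j; exact (hlevi _ (Fin.succAbove_ne i₀ j)).2
  have hcolH : colB (h : Matrix (Fin (N + 1)) (Fin (N + 1)) k) i₀ = 0 := by ext i u; exact hhcol _ (Fin.succAbove_ne i₀ i)
  have hblk : blk (g : Matrix (Fin (N + 1)) (Fin (N + 1)) k) i₀ = blk (h : Matrix (Fin (N + 1)) (Fin (N + 1)) k) i₀ := by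
    ext i j; exact hgh' _ _ (Fin.succAbove_ne i₀ i) (Fin.succAbove_ne i₀ j)
  -- inverses of the block-diagonal units `g`, `h`
  obtain ⟨hα, -, -, -, -⟩ := blocks_of_inverse (Units.mul_inv g) (Units.inv_mul g) hrowG hcolG
  obtain ⟨hβ, hrowHi, hcolHi, hMN, hNM⟩ := blocks_of_inverse (Units.mul_inv h) (Units.inv_mul h) hrowH hcolH
  let α : kˣ := ⟨_, _, hα, by rw [mul_comm]; exact hα⟩
  let β : kˣ := ⟨_, _, hβ, by rw [mul_comm]; exact hβ⟩
  let M : GL (Fin N) k := ⟨_, _, hMN, hNM⟩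
  -- reindex the lift equation along `borderEquiv i₀`
  have key := congrArg (fun X : Matrix _ _ (MvPolynomial σ k) => X.submatrix (borderEquiv i₀) (borderEquiv i₀)) hgh
  rw [← submatrix_mul_equiv _ _ _ (borderEquiv i₀) _,
    ← submatrix_mul_equiv ((g : Matrix (Fin (N + 1)) (Fin (N + 1)) k).map C) A _ (borderEquiv i₀) _] at key
  simp only [Matrix.linSubstEntries, submatrix_map] at key
  rw [hAe, submatrix_borderEquiv, submatrix_borderEquiv, hrowG, hcolG, hblk, hrowHi, hcolHi] at key
  exact nonempty_liftData_of_blocks (leviBlockGauge A i₀) α β M key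
end Assembly

/-! ## §4 The `m = 2` pad and the shape of the window group -/
section PerTwo
/-- Every element of the window group `biPermSubst m` IS a bi-permutation matrix `x_{ij} ↦ x_{σ i, τ j}`. -/
theorem exists_prodCongr_of_mem_biPermSubst {m : ℕ} {γ : GL (Fin m × Fin m) ℂ} (hγ : γ ∈ biPermSubst m) :
    ∃ σ τ : Equiv.Perm (Fin m), (γ : Matrix (Fin m × Fin m) (Fin m × Fin m) ℂ) = Equiv.Perm.permMatrix ℂ (Equiv.prodCongr σ τ) := by
  induction hγ using Subgroup.closure_induction with
  | mem x hx => exact hx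
  | one =>
    refine ⟨1, 1, ?_⟩
    rw [Units.val_one, show Equiv.prodCongr (1 : Equiv.Perm (Fin m)) 1 = 1 from Equiv.ext fun ⟨a, b⟩ => rfl,
      Matrix.permMatrix_one]
  | mul x y _ _ hx hy =>
    obtain ⟨σ, τ, hx⟩ := hx
    obtain ⟨σ', τ', hy⟩ := hy
    refine ⟨σ' * σ, τ' * τ, ?_⟩
    rw [Units.val_mul, hx, hy, ← Matrix.permMatrix_mul,
      show Equiv.prodCongr σ' τ' * Equiv.prodCongr σ τ = Equiv.prodCongr (σ' * σ) (τ' * τ) from Equiv.ext fun ⟨a, b⟩ => rfl]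
  | inv x _ hx =>
    obtain ⟨σ, τ, hx⟩ := hx
    refine ⟨σ⁻¹, τ⁻¹, ?_⟩
    rw [Matrix.coe_units_inv, hx]
    refine Matrix.inv_eq_left_inv ?_
    rw [← Matrix.permMatrix_mul, show Equiv.prodCongr σ τ * Equiv.prodCongr σ⁻¹ τ⁻¹ = 1 from Equiv.ext fun ⟨a, b⟩ => by simp,
      Matrix.permMatrix_one]

/-- A permutation as a unit matrix. -/
def permGL {n : Type*} [Fintype n] [DecidableEq n] (R : Type*) [CommRing R] (ρ : Equiv.Perm n) : GL n R :=
  ⟨ρ.permMatrix R, ρ⁻¹.permMatrix R, by rw [← Matrix.permMatrix_mul, inv_mul_cancel, Matrix.permMatrix_one],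
    by rw [← Matrix.permMatrix_mul, mul_inv_cancel, Matrix.permMatrix_one]⟩

/-- Permutation matrices are preserved by ring maps. -/
theorem permMatrix_map {n : Type*} [DecidableEq n] {R S : Type*} [CommRing R] [CommRing S] (ρ : Equiv.Perm n)
    (f : R →+* S) : (ρ.permMatrix R).map f = ρ.permMatrix S := by
  ext i j; simp [Equiv.Perm.permMatrix, PEquiv.toMatrix_apply, apply_ite f]

/-- The antipode `(a, b) ↦ (ā, b̄)` of `Fin 2 × Fin 2`. -/
def cpl (v : Fin 2 × Fin 2) : Fin 2 × Fin 2 := (Fin.rev v.1, Fin.rev v.2)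

/-- `𝔖_2` is abelian: every permutation of `Fin 2` commutes with the flip. -/
theorem perm_fin_two_rev (ρ : Equiv.Perm (Fin 2)) (a : Fin 2) : ρ (Fin.rev a) = Fin.rev (ρ a) := by
  have h1 : ∀ x y : Fin 2, y ≠ x → y = Fin.rev x := by decide
  have h2 : ∀ x : Fin 2, Fin.rev x ≠ x := by decide
  exact h1 _ _ fun h => h2 a (ρ.injective h)

/-- Bi-permutations commute with the antipode. -/
theorem prodCongr_cpl (σ τ : Equiv.Perm (Fin 2)) (v : Fin 2 × Fin 2) :
    Equiv.prodCongr σ τ (cpl v) = cpl (Equiv.prodCongr σ τ v) := by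
  simp only [Equiv.prodCongr_apply, Prod.map, cpl, perm_fin_two_rev]

/-- `Fin 4 ≃ Fin 2 × Fin 2`. -/
def idx : Fin 4 ≃ Fin 2 × Fin 2 := (finProdFinEquiv : Fin 2 × Fin 2 ≃ Fin 4).symm

/-- THE `m = 2` GAUGE: `Z = 0`, `ℓ = 0`, `r_v = x_v`, `c_v = -½ · x_v̄`. -/
def perTwoGauge : BlockGauge (Fin 2 × Fin 2) ℂ (Fin 4) where
  Z := 0
  c i := C (-(2⁻¹ : ℂ)) * X (cpl (idx i))
  r j := X (idx j)
  ℓ := 0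
  linZ _ _ := isHomogeneous_zero _ _ _
  linc _ := isHomogeneous_C_mul_X _ _
  linr _ := isHomogeneous_X _ _
  linℓ := isHomogeneous_zero _ _ _

/-- `det [[0, x], [-½ x̄, 1]] = ½ Σ_v x_v x_v̄ = per_2`. -/
theorem det_perTwoGauge : perTwoGauge.matrix.det = perPoly (Fin 2) ℂ := by
  have hper : perPoly (Fin 2) ℂ = X (0, 0) * X (1, 1) + X (0, 1) * X (1, 0) := by
    simp [perPoly, Matrix.permanent_fin_two_row, Matrix.mvPolynomialX]
  have h2 : (C (2⁻¹ : ℂ) : MvPolynomial (Fin 2 × Fin 2) ℂ) * 2 = 1 := by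
    rw [← map_ofNat C 2, ← map_mul, inv_mul_cancel₀ two_ne_zero, map_one]
  obtain ⟨c00, c01, c10, c11⟩ : cpl (0, 0) = (1, 1) ∧ cpl (0, 1) = (1, 0) ∧ cpl (1, 0) = (0, 1) ∧ cpl (1, 1) = (0, 0) := by
    decide
  have hsum : ∑ j : Fin 4, X (idx j) * (C (-(2⁻¹ : ℂ)) * X (cpl (idx j))) = -(C (2⁻¹ : ℂ) * (2 * perPoly (Fin 2) ℂ)) := by
    rw [Fintype.sum_equiv idx _ (fun v => X v * (C (-(2⁻¹ : ℂ)) * X (cpl v))) (fun _ => rfl)]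
    simp only [Fintype.sum_prod_type, Fin.sum_univ_two, c00, c01, c10, c11, hper, map_neg]
    ring
  have hm : perTwoGauge.matrix = fromBlocks (of fun (_ _ : Unit) => (0 : MvPolynomial (Fin 2 × Fin 2) ℂ))
      (of fun (_ : Unit) j => X (idx j)) (of fun i (_ : Unit) => C (-(2⁻¹ : ℂ)) * X (cpl (idx i))) 1 := by
    rw [BlockGauge.matrix, border]; simp only [perTwoGauge, add_zero]
  rw [hm, det_fromBlocks_one₂₂, det_unique]
  simp only [Matrix.sub_apply, of_apply, Matrix.mul_apply, hsum]
  linear_combination (perPoly (Fin 2) ℂ) * h2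

/-- Bi-permutations lift block-diagonally to the `m = 2` gauge: `M` = the bi-permutation on `Fin 4 ≃ Fin 2 × Fin 2`,
`α = β = 1`. -/
theorem nonempty_liftData_perTwoGauge (σ τ : Equiv.Perm (Fin 2)) {γ : GL (Fin 2 × Fin 2) ℂ}
    (hγ : (γ : Matrix (Fin 2 × Fin 2) (Fin 2 × Fin 2) ℂ) = Equiv.Perm.permMatrix ℂ (Equiv.prodCongr σ τ)) :
    Nonempty (perTwoGauge.LiftData γ) := by
  set π : Equiv.Perm (Fin 2 × Fin 2) := Equiv.prodCongr σ τ with hπ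
  let ρ : Equiv.Perm (Fin 4) := idx.symm.permCongr π.symm
  have hL : ∀ v, linSubst (Fin 2 × Fin 2) ℂ (γ : Matrix (Fin 2 × Fin 2) (Fin 2 × Fin 2) ℂ) (X v) = X (π.symm v) := by
    intro v; rw [hγ, linSubst_permMatrix, rename_X]
  have hρ : ∀ x, idx (ρ x) = π.symm (idx x) := fun x => by simp [ρ]
  have hπc : ∀ v, π.symm (cpl v) = cpl (π.symm v) := fun v => by rw [hπ, Equiv.prodCongr_symm, prodCongr_cpl]
  refine ⟨{ M := permGL ℂ ρ, α := 1, β := 1, mapZ := ?_, mapc := ?_, mapr := ?_, mapℓ := ?_ }⟩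
  · ext i j; simp [perTwoGauge, Matrix.linSubstEntries]
  · intro i
    rw [show ((permGL ℂ ρ : GL (Fin 4) ℂ) : Matrix (Fin 4) (Fin 4) ℂ) = ρ.permMatrix ℂ from rfl, permMatrix_map,
      Matrix.permMatrix_mulVec]
    simp only [perTwoGauge, inv_one, Units.val_one, C_1, one_mul, Function.comp_apply, map_mul, linSubst_C, hL, hπc, hρ]
  · intro j
    rw [show (((permGL ℂ ρ)⁻¹ : GL (Fin 4) ℂ) : Matrix (Fin 4) (Fin 4) ℂ) = ρ⁻¹.permMatrix ℂ from rfl, permMatrix_map,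
      Matrix.vecMul_permMatrix]
    simp only [perTwoGauge, Units.val_one, C_1, one_mul, Function.comp_apply, hL]
    rw [show (ρ⁻¹).symm = ρ from rfl, hρ]
  · simp [perTwoGauge]

/-- **THE `m = 2` PAD (KERNEL):** `per_2` has `biPermSubst 2`-equivariant block-gauge data of inner size `4`. -/
theorem hasBlockGaugeRepr_perPoly_two : HasBlockGaugeRepr (biPermSubst 2) (perPoly (Fin 2) ℂ) 4 :=
  ⟨perTwoGauge, det_perTwoGauge, fun _ hγ => by
    obtain ⟨σ, τ, h⟩ := exists_prodCongr_of_mem_biPermSubst hγ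
    exact nonempty_liftData_perTwoGauge σ τ h⟩
end PerTwo

/-! ## §5 `CoLeviLifts` and Theorem H conditional -/
section TheoremH
/-- **`CoLeviLifts`** — [status: paper — LR17 §3.6 step 1 + finite supplement (Borel–Serre / Platonov / Brion 2015
Thm 1.1) + Maschke; NOT proved in the tree].  NAMED PAPER STUB used ONLY as a hypothesis (no `_holds` theorem, no
instance, no default argument ever discharges it): for `m ≥ 3`, every REGULAR `biPermSubst m`-equivariant affine
determinantal representation of `per_m` of size `s` can be replaced by one of the same size with COORDINATE LEVI LIFTS.
Paper argument: normal form `A(0) = Λ_{i₀}` (tree `IsRegularDetRepr.exists_normalForm`); a finite subgroup of the lift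
group `𝔾_A` surjects onto the (finite) window group (finite supplement); Maschke gives complements of `range Λ` /
`ker Λ` stable under it; adapted bases make the lifts block-diagonal.  Implied by skeleton-v3 `LeviLifts` via adapted
bases (stage 2, uncalled).  Census: a TYPED STUB exactly like `BlockGaugeCost` (0 S-currency; not a fact, not an item). -/
def CoLeviLifts : Prop :=
  ∀ m s : ℕ, 3 ≤ m → ∀ A : Matrix (Fin s) (Fin s) (MvPolynomial (Fin m × Fin m) ℂ),
    IsEquivariantDetRepr (biPermSubst m) (perPoly (Fin m) ℂ) A → IsRegularDetRepr (perPoly (Fin m) ℂ) A →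
      ∃ (A' : Matrix (Fin s) (Fin s) (MvPolynomial (Fin m × Fin m) ℂ)) (i₀ : Fin s),
        IsAffineDetRepr (perPoly (Fin m) ℂ) A' ∧ HasLeviLiftsAt (biPermSubst m) A' i₀

/-- **ARROW 1 OF THEOREM H (KERNEL modulo the paper stub and von zur Gathen's theorem):** coordinate Levi lifts for
`m ≥ 3` (regularity from `vonzurGathen1987_perm_detRepr_rank`) and the `m = 2` pad give a uniform polynomial BLOCK-GAUGE
COST at the window: inner size `s - 1`, resp. `4`, both `≤ 2 (m + s + 1)`. -/
theorem blockGaugeCost_of_coLeviLifts (hco : CoLeviLifts) (hvzg : vonzurGathen1987_perm_detRepr_rank) :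
    BlockGaugeCost biPermSubst := by
  refine ⟨2, 1, fun m s hm hA => ?_⟩
  obtain ⟨A, hA⟩ := hA
  rcases Nat.lt_or_ge m 3 with hlt | hge
  · obtain rfl : m = 2 := by omega
    exact ⟨4, by rw [pow_one]; omega, hasBlockGaugeRepr_perPoly_two⟩
  · have hreg := IsEquivariantDetRepr.isRegular_perPoly hvzg hge hA
    obtain ⟨A', i₀, hA', hL⟩ := hco m s hge A hA hreg
    cases s with
    | zero => exact i₀.elim0
    | succ N => exact ⟨N, by rw [pow_one]; omega, hasBlockGaugeRepr_of_hasLeviLiftsAt hA' hL⟩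

/-- **THEOREM H CONDITIONAL (KERNEL):** `CoLeviLifts ∧ vzG ⟹ GradingCost biPermSubst` (arrows 2 + 3 are the tree's
`gradingCost_of_blockGaugeCost`). -/
theorem gradingCost_biPerm_of_coLeviLifts (hco : CoLeviLifts) (hvzg : vonzurGathen1987_perm_detRepr_rank) :
    GradingCost biPermSubst :=
  gradingCost_of_blockGaugeCost (blockGaugeCost_of_coLeviLifts hco hvzg)

/-- … hence cell `A` IS its layered version, `A ⟺ A^lay`, given `CoLeviLifts` and vzG. -/
theorem eqHardBiPerm_iff_layered_of_coLeviLifts (hco : CoLeviLifts) (hvzg : vonzurGathen1987_perm_detRepr_rank) :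
    EqHardBiPerm ↔ EqHardLayeredBiPerm :=
  eqHardBiPerm_iff_layered_of_blockGaugeCost (blockGaugeCost_of_coLeviLifts hco hvzg)

/-- … and its graded version, `A ⟺ A^gr`, given `CoLeviLifts` and vzG. -/
theorem eqHardBiPerm_iff_graded_of_coLeviLifts (hco : CoLeviLifts) (hvzg : vonzurGathen1987_perm_detRepr_rank) :
    EqHardBiPerm ↔ EqHardBiPermGraded :=
  eqHardBiPerm_iff_graded (gradingFree_of_cost (gradingCost_biPerm_of_coLeviLifts hco hvzg))
end TheoremH

end

end Summit.ValiantsHypothesis.ValiantsHypothesis.Theorems.EquivariantDialLayers
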